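import Literature.NumberTheory.EllipticCurves.GrossPointsThetaElement
import Literature.NumberTheory.EllipticCurves.HeegnerPointsOfConductor
import Mathlib.LinearAlgebra.Finsupp.LinearCombination
import HarnessLib

/-!
# Kolyvagin-derived Gross points: `P(n) = Σ_{σ ∈ 𝒢} σ(D_n x(n))` on a definite Shimura set and its value `⟨P(n), φ⟩`

Topic `Literature/NumberTheory/EllipticCurves` (fourth file on Gross points, after `GrossPoints`,
`GrossPointsPicardAction`, `GrossPointsThetaElement`).  W. Zhang, *Selmer groups and the
indivisibility of Heegner points*, Camb. J. Math. 2 (2014) [WZhang2014], §3.7 (PDF p. 212) defines,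
for `n ∈ Λ` (a squarefree product of Kolyvagin primes), `G_n = Gal(K[n]/K[1]) = ∏_{ℓ ∣ n} G_ℓ` with
`G_ℓ = Gal(K[ℓ]/K[1])` cyclic of order `ℓ + 1`, a generator `σ_ℓ` of `G_ℓ`, **Kolyvagin's derivative
operators** `D_ℓ := Σ_{i=1}^{ℓ} i σ_ℓ^i ∈ ℤ[G_ℓ]`, `D_n := ∏_{ℓ ∣ n} D_ℓ ∈ ℤ[G_n]`, a set `𝒢` of
representatives of `𝒢_n/G_n` (`𝒢_n = Gal(K[n]/K)`), and the **derived Heegner point**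
`P(n) := Σ_{σ ∈ 𝒢} σ(D_n y(n))` (Gross 1991, (3.5) and (4.1): the same formulas for `X₀(N)`).  The tree
already has these operators for ANY monoid acting on an additive group
(`KolyvaginOperator.derivOp / derivOpProd / derivedPoint`, file `HeegnerPointsOfConductor`).

§3.3 of [WZhang2014] ((3.9)–(3.11), PDF p. 207) puts the SAME Heegner points `x_m(n)` (formula (3.7))
on the Shimura SET `X_m` of a DEFINITE quaternion algebra (when `m` has an odd number of prime
factors), with the Galois action (3.6) `σ[h] = [rec(σ) h]` of `Gal(K^{ab}/K)` on `C_{K,m}`, and Thm. 3.1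
(PDF pp. 210–211) identifies the reduction `Red_q(x_m(n))` of the CM points of the Shimura CURVE `X_m`
with the points `x_{mq}(n) ∈ C_{mq,K}` of the set; the local Kummer map of a Heegner divisor at `q` is
then read off by evaluating a Hecke eigenform `φ : X_{mq} → k₀` on the reduced divisor, linearly on
`ℤ[X_{mq}]` ((4.7)–(4.9) and the diagram `Div⁰(C_K) → ℤ[X_{mq}]⁰ →^φ k₀`, PDF pp. 218–219), so that
`loc_q c(n, m)` is `φ` evaluated on `Σ_{σ ∈ 𝒢} σ(D_n x_{mq}(n))` ("the cohomology classes `c(n, m)` are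
the Kummer images of the points `P_m(n)` derived from `y_m(n)`", p. 220).  In the tree's model of the
definite side (Bertolini–Darmon 1996 §2.1, §2.3: the Gross space `GrossSpace D K` of CM pairs
`[(f, I)]`, its conductor-`c` Heegner points `grossPoints K S c`, and the action (4) of
`Pic(𝒪_c) = ClassGroup (quadOrder K c)` — which is `Gal(K[c]/K)` under class field theory —
`GrossSpace.picardMulAction c`), this file TRANSPORTS those printed definitions; nothing is asserted:

* `GrossSpace.divisorRep c : Pic(𝒪_c) →* AddMonoid.End (GrossSpace D K →₀ ℤ)` — the permutation
  module `ℤ[GrossSpace]` of the `Pic(𝒪_c)`-action (Zhang's `ℤ[X_m]`, `Div(C_K)` with (3.6));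
* `GrossSpace.divisorValue S φ : (GrossSpace S.D K →₀ ℤ) →ₗ[ℤ] ℤ` — the linear extension to divisors of
  the tree's value `⟨x, φ⟩ = GrossSpace.yValue S φ x` of a Brandt-module vector `φ : Cls O → ℤ`
  (BD96 §1.9 `⟨D, v_f⟩`; Zhang's `φ` on `ℤ[X_{mq}]`);
* `GrossKolyvaginChoice K c` — the CHOICES of §3.7 at conductor `c`, phrased in `Pic(𝒪_c)`:
  `σ ℓ ∈ G_ℓ := ker(Pic(𝒪_c) → Pic(𝒪_{c/ℓ}))` (`= Gal(K[c]/K[c/ℓ])`, the tree's `picRes`) generating it,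
  for the primes `ℓ ∣ c`, and a finite transversal `reps` (`= 𝒢`) of `Pic(𝒪_c)` modulo the subgroup
  generated by the `σ ℓ` (`= G_c = ∏ G_ℓ`);
* `GrossKolyvaginChoice.derivedDivisor ch x := Σ_{s ∈ 𝒢} s • D_c [x] ∈ ℤ[GrossSpace]` — Zhang's `P(n)`
  for a point `x` of the set (intended: `x ∈ grossPoints K S c`, `c` squarefree), literally
  `KolyvaginOperator.derivedPoint (divisorRep c) ch.σ c ch.reps (single x 1)`;
* `GrossKolyvaginChoice.derivedValue S φ ch x := ⟨P(c), φ⟩ ∈ ℤ` and its reduction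
  `derivedValueMod p` in `ZMod p` (Zhang's `φ(P) ∈ k₀`).

PROVED API (bookkeeping of the cited formulas, or Gross's identity (3.5)): `divisorRep_single`,
`divisorValue_single`; at conductor `1` (`D_1 = 1`, Zhang (3.22) `P(1) = tr y(1) = y_K`):
`derivedDivisor_one`, `derivedValue_one` (`= Σ_{s ∈ 𝒢} ⟨s • x, φ⟩`, the shape of Gross's period
`Σ_{σ ∈ Pic(𝓞_K)} ⟨σ x, φ⟩` of Gross 1987 §3 / [WZhang2014] (6.1)–(6.2)), the canonical choice
`GrossKolyvaginChoice.one` (`𝒢 = Pic(𝓞_K)`); at a prime conductor `ℓ`: `derivedDivisor_prime`;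
and, for Kolyvagin's operator of ANY `ρ : G →* AddMonoid.End A` on an additive group, the telescoping
identity **`σ(D_ℓ y) − D_ℓ y = (ℓ + 1) y − Tr_ℓ y`** when `σ^{ℓ+1} = 1`
(`KolyvaginOperator.apply_derivOp_sub_derivOp`; Gross 1991 (3.5) `(σ_ℓ − 1) D_ℓ = ℓ + 1 − Tr_ℓ`; the
group-ring form is the tree's `KolyvaginEuler.of_sub_one_mul_derivElt`), its divisibility corollary
`KolyvaginOperator.exists_apply_derivOp_sub_derivOp_eq_zsmul` (`p ∣ ℓ + 1`, `Tr_ℓ y ∈ pA` ⇒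
`(σ − 1) D_ℓ y ∈ pA` — the mechanism behind the `Gal(K[n]/K)`-invariance of `P(n)` mod `p`, Zhang p. 212,
Gross Prop. 3.6), additivity `KolyvaginOperator.derivOp_add/…`, and the commutation rules
`KolyvaginOperator.apply_derivOp_comm / apply_derivOpProd_comm` for commuting group elements.

HONEST FRAMING.  (1) Definitions + bookkeeping only: no statement about Gross points, norm relations
(BD96 §2.4), Jochnowitz congruences or `L`-values is made; in particular the independence of
`derivedValueMod` of the choices (true only modulo `p` and only for genuine Kolyvagin data) is NOT
asserted.  (2) `G_ℓ` is cyclic of order `ℓ + 1` for `ℓ` inert in `K` and prime to `c/ℓ · disc K` (class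
number formula for orders); the structure merely RECORDS a generator, as the tree's
`KolyvaginHeegnerData.σ` / `RingClassKolyvaginChoice.σ` do on the curve side.  (3) `D_c` runs along
`c.primeFactorsList` (increasing); for squarefree `c` this is Zhang's `∏_{ℓ ∣ n} D_ℓ` (the operators
commute, `apply_derivOp_comm`).  (4) Consumer: the `p = 3` bipartite-Euler-system bookkeeping of route
`KolyvaginRoadThree` (crux `ZhangSharpFrameAtThreeHL`), whose definite-side values `λ(m, n′)` are
`derivedValueMod 3` of Gross points of conductor `∏ m` on the set of discriminant `∏ n′`; the
curve-specific predicates (mod-`p` eigenlines, level raising) live there, not here.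
No instance, no notation, no `sorry`, no named fact.

## References

* [WZhang2014] W. Zhang, *Selmer groups and the indivisibility of Heegner points*, Camb. J. Math. 2
  (2014) 191–253: §3.2 (3.6)–(3.8) (PDF pp. 206–207), §3.3 (3.9)–(3.11) (p. 207), Thm. 3.1
  (pp. 210–211), §3.7 `D_ℓ`, `D_n`, `𝒢`, `P(n)` (p. 212), (3.22) (p. 213), (4.7)–(4.9) (pp. 218–219).
* [GrossLMS1991] B. H. Gross, *Kolyvagin's work on modular elliptic curves*, LMS Lecture Notes 153
  (1991), §3 (3.5), Prop. 3.6, §4 (4.1).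
* [BertoliniDarmon1996] M. Bertolini, H. Darmon, *Heegner points on Mumford–Tate curves*, Invent.
  Math. 126 (1996), §1.9, §2.1, §2.3 (4).
* [Gross1987] B. H. Gross, *Heights and the special values of `L`-series*, CMS Conf. Proc. 7 (1987), §3.
-/

noncomputable section

open Finset
open NumberField Literature.NumberTheory.Automorphic

universe u v

namespace Literature.NumberTheory.EllipticCurves

/-! ### §1. Generic identities for Kolyvagin's operator `D_ℓ = Σ_{i=1}^{ℓ} i σ^i` -/

namespace KolyvaginOperator

section AddCommMonoid

variable {G : Type*} [Monoid G] {A : Type*} [AddCommMonoid A] (ρ : G →* AddMonoid.End A)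

/-- **The trace-type operator `Tr_ℓ y := Σ_{i=0}^{ℓ} σ^i y`** (for `σ` of order `ℓ + 1` this is
the trace `Tr_{G_ℓ} = Σ_{g ∈ G_ℓ} g` of Gross 1991, §3 (3.5); Zhang 2014, §3.7). [cite: GrossLMS1991, §3 (3.5)] -/
def traceOp (σ : G) (ℓ : ℕ) (y : A) : A :=
  ∑ i ∈ range (ℓ + 1), ρ (σ ^ i) y

/-- `Tr_ℓ y = y + Σ_{i<ℓ} σ^{i+1} y`. [cite: GrossLMS1991, §3 (3.5)] -/
theorem traceOp_eq_add_sum (σ : G) (ℓ : ℕ) (y : A) :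
    traceOp ρ σ ℓ y = y + ∑ i ∈ range ℓ, ρ (σ ^ (i + 1)) y := by
  unfold traceOp
  rw [sum_range_succ' (fun i => ρ (σ ^ i) y)]
  simp only [pow_zero, map_one, AddMonoid.End.coe_one, id_eq]
  exact add_comm _ _

/-- `D_ℓ` is additive: `D_ℓ (y + z) = D_ℓ y + D_ℓ z`. [cite: GrossLMS1991, §3 (3.5)] -/
theorem derivOp_add (σ : G) (ℓ : ℕ) (y z : A) :
    derivOp ρ σ ℓ (y + z) = derivOp ρ σ ℓ y + derivOp ρ σ ℓ z := by
  unfold derivOp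
  simp only [map_add, smul_add, sum_add_distrib]

/-- `D_ℓ 0 = 0`. [cite: GrossLMS1991, §3 (3.5)] -/
@[simp] theorem derivOp_zero (σ : G) (ℓ : ℕ) : derivOp ρ σ ℓ (0 : A) = 0 := by
  unfold derivOp
  simp only [map_zero, smul_zero, sum_const_zero]

/-- **`D_ℓ` as an additive endomorphism** `Σ_{i=0}^{ℓ} i • ρ(σ^i)`. [cite: GrossLMS1991, §3 (3.5)] -/
def derivOpHom (σ : G) (ℓ : ℕ) : A →+ A where
  toFun := derivOp ρ σ ℓ
  map_zero' := derivOp_zero ρ σ ℓ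
  map_add' := derivOp_add ρ σ ℓ

/-- `derivOpHom` is `D_ℓ` (definitional). [cite: GrossLMS1991, §3 (3.5)] -/
@[simp] theorem derivOpHom_apply (σ : G) (ℓ : ℕ) (y : A) : derivOpHom ρ σ ℓ y = derivOp ρ σ ℓ y :=
  rfl

/-- `D_ℓ (n • y) = n • D_ℓ y`. [cite: GrossLMS1991, §3 (3.5)] -/
theorem derivOp_nsmul (σ : G) (ℓ : ℕ) (n : ℕ) (y : A) :
    derivOp ρ σ ℓ (n • y) = n • derivOp ρ σ ℓ y :=
  map_nsmul (derivOpHom ρ σ ℓ) n y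

/-- `D_ℓ (Σ_s f s) = Σ_s D_ℓ (f s)`. [cite: GrossLMS1991, §3 (3.5)] -/
theorem derivOp_sum {ι : Type*} (σ : G) (ℓ : ℕ) (s : Finset ι) (f : ι → A) :
    derivOp ρ σ ℓ (∑ i ∈ s, f i) = ∑ i ∈ s, derivOp ρ σ ℓ (f i) :=
  map_sum (derivOpHom ρ σ ℓ) f s

/-- `D` along a list is additive. [cite: GrossLMS1991, §3 (3.5)] -/
theorem derivOpProd_add (σ : ℕ → G) (L : List ℕ) (y z : A) :
    derivOpProd ρ σ L (y + z) = derivOpProd ρ σ L y + derivOpProd ρ σ L z := by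
  induction L with
  | nil => rfl
  | cons ℓ L ih => rw [derivOpProd_cons, derivOpProd_cons, derivOpProd_cons, ih, derivOp_add]

/-- `D` along a list kills `0`. [cite: GrossLMS1991, §3 (3.5)] -/
@[simp] theorem derivOpProd_zero (σ : ℕ → G) (L : List ℕ) : derivOpProd ρ σ L (0 : A) = 0 := by
  induction L with
  | nil => rfl
  | cons ℓ L ih => rw [derivOpProd_cons, ih, derivOp_zero]

/-- **`D_L` as an additive endomorphism.** [cite: GrossLMS1991, §3 (3.5)] -/
def derivOpProdHom (σ : ℕ → G) (L : List ℕ) : A →+ A where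
  toFun := derivOpProd ρ σ L
  map_zero' := derivOpProd_zero ρ σ L
  map_add' := derivOpProd_add ρ σ L

/-- `derivOpProdHom` is `D_L` (definitional). [cite: GrossLMS1991, §3 (3.5)] -/
@[simp] theorem derivOpProdHom_apply (σ : ℕ → G) (L : List ℕ) (y : A) :
    derivOpProdHom ρ σ L y = derivOpProd ρ σ L y :=
  rfl

/-- `D_L (Σ_s f s) = Σ_s D_L (f s)`. [cite: GrossLMS1991, §3 (3.5)] -/
theorem derivOpProd_sum {ι : Type*} (σ : ℕ → G) (L : List ℕ) (s : Finset ι) (f : ι → A) :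
    derivOpProd ρ σ L (∑ i ∈ s, f i) = ∑ i ∈ s, derivOpProd ρ σ L (f i) :=
  map_sum (derivOpProdHom ρ σ L) f s

/-- `D_L (n • y) = n • D_L y`. [cite: GrossLMS1991, §3 (3.5)] -/
theorem derivOpProd_nsmul (σ : ℕ → G) (L : List ℕ) (n : ℕ) (y : A) :
    derivOpProd ρ σ L (n • y) = n • derivOpProd ρ σ L y :=
  map_nsmul (derivOpProdHom ρ σ L) n y

end AddCommMonoid

section Comm

variable {G : Type*} [CommMonoid G] {A : Type*} [AddCommMonoid A] (ρ : G →* AddMonoid.End A)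

/-- For a COMMUTATIVE `G`, every `g ∈ G` commutes with `D_ℓ`: `g (D_ℓ y) = D_ℓ (g y)`
(`D_n ∈ ℤ[G_n]`, a commutative group ring). [cite: GrossLMS1991, §3 (3.5)] [cite: WZhang2014, §3.7 (PDF p. 212)] -/
theorem apply_derivOp_comm (g σ : G) (ℓ : ℕ) (y : A) :
    ρ g (derivOp ρ σ ℓ y) = derivOp ρ σ ℓ (ρ g y) := by
  unfold derivOp
  rw [map_sum]
  refine sum_congr rfl fun i _ => ?_
  rw [map_nsmul]
  congr 1
  change (ρ g * ρ (σ ^ i)) y = (ρ (σ ^ i) * ρ g) y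
  rw [← map_mul, ← map_mul, mul_comm]

/-- For a commutative `G`, every `g ∈ G` commutes with `D_L`. [cite: GrossLMS1991, §3 (3.5)] -/
theorem apply_derivOpProd_comm (g : G) (σ : ℕ → G) (L : List ℕ) (y : A) :
    ρ g (derivOpProd ρ σ L y) = derivOpProd ρ σ L (ρ g y) := by
  induction L with
  | nil => rfl
  | cons ℓ L ih => rw [derivOpProd_cons, derivOpProd_cons, apply_derivOp_comm, ih]

/-- For a commutative `G`, `Tr_ℓ` commutes with `D_L`. [cite: GrossLMS1991, §3 (3.5)] -/
theorem traceOp_derivOpProd_comm (τ : G) (m : ℕ) (σ : ℕ → G) (L : List ℕ) (y : A) :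
    traceOp ρ τ m (derivOpProd ρ σ L y) = derivOpProd ρ σ L (traceOp ρ τ m y) := by
  unfold traceOp
  rw [derivOpProd_sum]
  exact sum_congr rfl fun i _ => apply_derivOpProd_comm ρ _ σ L y

/-- For a commutative `G`, the operators `D_ℓ^σ` and `D_m^τ` commute. [cite: GrossLMS1991, §3 (3.5)] -/
theorem derivOp_derivOp_comm (σ τ : G) (ℓ m : ℕ) (y : A) :
    derivOp ρ σ ℓ (derivOp ρ τ m y) = derivOp ρ τ m (derivOp ρ σ ℓ y) := by
  calc derivOp ρ σ ℓ (derivOp ρ τ m y)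
      = ∑ i ∈ range (ℓ + 1), i • ρ (σ ^ i) (derivOp ρ τ m y) := rfl
    _ = ∑ i ∈ range (ℓ + 1), derivOp ρ τ m (i • ρ (σ ^ i) y) :=
        sum_congr rfl fun i _ => by rw [apply_derivOp_comm, derivOp_nsmul]
    _ = derivOp ρ τ m (∑ i ∈ range (ℓ + 1), i • ρ (σ ^ i) y) := (derivOp_sum ρ τ m _ _).symm
    _ = derivOp ρ τ m (derivOp ρ σ ℓ y) := rfl

end Comm

section AddCommGroup

variable {G : Type*} [Monoid G] {A : Type*} [AddCommGroup A] (ρ : G →* AddMonoid.End A)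

/-- `D_ℓ (m • y) = m • D_ℓ y` for `m ∈ ℤ` (`D_ℓ ∈ ℤ[G_ℓ]` acts `ℤ`-linearly). [cite: GrossLMS1991, §3 (3.5)] -/
theorem derivOp_zsmul (σ : G) (ℓ : ℕ) (m : ℤ) (y : A) :
    derivOp ρ σ ℓ (m • y) = m • derivOp ρ σ ℓ y :=
  map_zsmul (derivOpHom ρ σ ℓ) m y

/-- `D_ℓ (y − z) = D_ℓ y − D_ℓ z`. [cite: GrossLMS1991, §3 (3.5)] -/
theorem derivOp_sub (σ : G) (ℓ : ℕ) (y z : A) :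
    derivOp ρ σ ℓ (y - z) = derivOp ρ σ ℓ y - derivOp ρ σ ℓ z :=
  map_sub (derivOpHom ρ σ ℓ) y z

/-- `D_L (m • y) = m • D_L y` for `m ∈ ℤ`. [cite: GrossLMS1991, §3 (3.5)] -/
theorem derivOpProd_zsmul (σ : ℕ → G) (L : List ℕ) (m : ℤ) (y : A) :
    derivOpProd ρ σ L (m • y) = m • derivOpProd ρ σ L y :=
  map_zsmul (derivOpProdHom ρ σ L) m y

/-- `D_L (y − z) = D_L y − D_L z`. [cite: GrossLMS1991, §3 (3.5)] -/
theorem derivOpProd_sub (σ : ℕ → G) (L : List ℕ) (y z : A) :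
    derivOpProd ρ σ L (y - z) = derivOpProd ρ σ L y - derivOpProd ρ σ L z :=
  map_sub (derivOpProdHom ρ σ L) y z

/-- **Gross's identity (3.5), `(σ_ℓ − 1) D_ℓ = ℓ + 1 − Tr_ℓ`, applied to a point**: if
`σ^{ℓ+1} = 1` then `σ(D_ℓ y) − D_ℓ y = (ℓ + 1) • y − Tr_ℓ y` for every `y`, for ANY monoid `G`
acting on an additive group `A` through `ρ` (telescoping: `σ D_ℓ = Σ_{i=1}^{ℓ} i σ^{i+1}
= Σ_{j=1}^{ℓ+1} (j − 1) σ^j`).  The group-ring form is the tree's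
`KolyvaginEuler.of_sub_one_mul_derivElt`. [cite: GrossLMS1991, §3 (3.5)] [cite: WZhang2014, §3.7 (PDF p. 212)] -/
theorem apply_derivOp_sub_derivOp (σ : G) (ℓ : ℕ) (hσ : σ ^ (ℓ + 1) = 1) (y : A) :
    ρ σ (derivOp ρ σ ℓ y) - derivOp ρ σ ℓ y = (ℓ + 1) • y - traceOp ρ σ ℓ y := by
  have hmul : ∀ i : ℕ, ρ σ (ρ (σ ^ i) y) = ρ (σ ^ (i + 1)) y := fun i => by
    change (ρ σ * ρ (σ ^ i)) y = _
    rw [← map_mul, ← pow_succ']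
  have hD : derivOp ρ σ ℓ y = ∑ i ∈ range ℓ, (i + 1) • ρ (σ ^ (i + 1)) y := by
    unfold derivOp
    rw [sum_range_succ' (fun i => i • ρ (σ ^ i) y)]
    simp only [zero_smul, add_zero]
  have hσD : ρ σ (derivOp ρ σ ℓ y) = ∑ i ∈ range ℓ, i • ρ (σ ^ (i + 1)) y + ℓ • y := by
    unfold derivOp
    rw [map_sum, sum_range_succ]
    congr 1
    · exact sum_congr rfl fun i _ => by rw [map_nsmul, hmul]
    · rw [map_nsmul, hmul, hσ, map_one, AddMonoid.End.coe_one, id_eq]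
  rw [hσD, hD, traceOp_eq_add_sum]
  simp only [succ_nsmul, sum_add_distrib]
  abel

/-- **Divisibility corollary**: if `σ^{ℓ+1} = 1`, `p ∣ ℓ + 1` and `Tr_ℓ y ∈ pA`, then
`σ(D_ℓ y) − D_ℓ y ∈ pA` — the computation behind "the Kummer image of `P(n)` is `Gal(K[n]/K)`-invariant
for `M ≤ M(n)`" (Zhang 2014, PDF pp. 212–213; Gross 1991, Prop. 3.6: `p ∣ ℓ + 1` and
`Tr_ℓ y_n = a_ℓ y_{n/ℓ}` with `p ∣ a_ℓ`). [cite: GrossLMS1991, Prop. 3.6] [cite: WZhang2014, §3.7 (PDF pp. 212–213)] -/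
theorem exists_apply_derivOp_sub_derivOp_eq_zsmul (σ : G) (ℓ : ℕ) (hσ : σ ^ (ℓ + 1) = 1) (y : A)
    {p : ℤ} (hp : p ∣ (ℓ + 1 : ℤ)) (htr : ∃ z : A, traceOp ρ σ ℓ y = p • z) :
    ∃ z : A, ρ σ (derivOp ρ σ ℓ y) - derivOp ρ σ ℓ y = p • z := by
  obtain ⟨k, hk⟩ := hp
  obtain ⟨z, hz⟩ := htr
  refine ⟨k • y - z, ?_⟩
  rw [apply_derivOp_sub_derivOp ρ σ ℓ hσ y, hz, zsmul_sub, smul_smul, ← hk]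
  congr 1
  rw [← natCast_zsmul]
  push_cast
  rfl

/-- `D` along `ℓ :: L`, i.e. `D_ℓ ∘ D_L`, satisfies `σ_ℓ(D_{ℓ::L} y) − D_{ℓ::L} y
= (ℓ + 1) • D_L y − Tr_ℓ (D_L y)` when `σ_ℓ^{ℓ+1} = 1`. [cite: GrossLMS1991, §3 (3.5)] -/
theorem apply_derivOpProd_cons_sub (σ : ℕ → G) (ℓ : ℕ) (L : List ℕ) (hσ : σ ℓ ^ (ℓ + 1) = 1)
    (y : A) :
    ρ (σ ℓ) (derivOpProd ρ σ (ℓ :: L) y) - derivOpProd ρ σ (ℓ :: L) y =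
      (ℓ + 1) • derivOpProd ρ σ L y - traceOp ρ (σ ℓ) ℓ (derivOpProd ρ σ L y) := by
  rw [derivOpProd_cons]
  exact apply_derivOp_sub_derivOp ρ (σ ℓ) ℓ hσ _

end AddCommGroup

end KolyvaginOperator

/-! ### §2. The permutation module `ℤ[GrossSpace]` of `Pic(𝒪_c)` and the value of a divisor -/

variable {D : Type v} [Ring D] [Algebra ℚ D] {K : Type u} [Field K] [NumberField K]

namespace GrossSpace

variable (D K) in
/-- **The divisor representation of `Pic(𝒪_c)`**: the permutation module `ℤ[GrossSpace D K]`
(finitely supported `ℤ`-valued functions) of the action `GrossSpace.picardMulAction c` of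
`Pic(𝒪_c) = ClassGroup (quadOrder K c)` (BD96 §2.3 (4); Zhang 2014 (3.6): the Galois action on
`C_{K,m}`, extended to divisors `Div(C_K)`, `ℤ[X_m]`), as a monoid homomorphism to the additive
endomorphisms, `[𝔞] ↦ (Σ n_x [x] ↦ Σ n_x [𝔞 • x])`. [cite: BertoliniDarmon1996, §2.3 (4)]
[cite: WZhang2014, §3.2 (3.6), §4 (PDF p. 219)] -/
def divisorRep (c : ℕ) [NeZero c] :
    ClassGroup (quadOrder K c) →* AddMonoid.End (GrossSpace D K →₀ ℤ) where
  toFun g := Finsupp.mapDomain.addMonoidHom (fun x : GrossSpace D K => g • x)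
  map_one' := by
    rw [show (fun x : GrossSpace D K => (1 : ClassGroup (quadOrder K c)) • x) = id from
      funext fun x => one_smul _ x, Finsupp.mapDomain.addMonoidHom_id]
    rfl
  map_mul' g h := by
    rw [show (fun x : GrossSpace D K => (g * h) • x) = (fun x => g • x) ∘ (fun x => h • x) from
      funext fun x => mul_smul g h x, Finsupp.mapDomain.addMonoidHom_comp]
    rfl

/-- `[𝔞]` acts on a divisor by `mapDomain (𝔞 • ·)`. [cite: BertoliniDarmon1996, §2.3 (4)] -/
theorem divisorRep_apply (c : ℕ) [NeZero c] (g : ClassGroup (quadOrder K c))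
    (f : GrossSpace D K →₀ ℤ) :
    divisorRep D K c g f = Finsupp.mapDomain (fun x : GrossSpace D K => g • x) f :=
  rfl

/-- `[𝔞] • (n [x]) = n [𝔞 • x]`. [cite: BertoliniDarmon1996, §2.3 (4)] -/
@[simp] theorem divisorRep_single (c : ℕ) [NeZero c] (g : ClassGroup (quadOrder K c))
    (x : GrossSpace D K) (n : ℤ) :
    divisorRep D K c g (Finsupp.single x n) = Finsupp.single (g • x) n := by
  rw [divisorRep_apply, Finsupp.mapDomain_single]

variable {Nplus Nminus : ℕ}

/-- **The value `⟨Σ n_x [x], φ⟩ := Σ n_x ⟨x, φ⟩` of a divisor on the Gross space** against a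
Brandt-module vector `φ : Cls O → ℤ`: the `ℤ`-linear extension of `GrossSpace.yValue S φ`
(BD96 §1.9 `⟨D, v_f⟩` on divisors; Zhang 2014 (4.7)–(4.9): `φ` on `ℤ[X_{mq}]`).
[cite: BertoliniDarmon1996, §1.9] [cite: WZhang2014, (4.7)–(4.9) (PDF pp. 218–219)] -/
def divisorValue (S : Brandt.XiSetup Nplus Nminus) (φ : Brandt.ClassSet S.O → ℤ) :
    (GrossSpace S.D K →₀ ℤ) →ₗ[ℤ] ℤ :=
  Finsupp.linearCombination ℤ (GrossSpace.yValue S φ)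

/-- `⟨n [x], φ⟩ = n ⟨x, φ⟩`. [cite: BertoliniDarmon1996, §1.9] -/
@[simp] theorem divisorValue_single (S : Brandt.XiSetup Nplus Nminus) (φ : Brandt.ClassSet S.O → ℤ)
    (x : GrossSpace S.D K) (n : ℤ) :
    divisorValue S φ (Finsupp.single x n) = n * GrossSpace.yValue S φ x := by
  rw [divisorValue, Finsupp.linearCombination_single, smul_eq_mul]

/-- `⟨f, φ⟩ = Σ_x f(x) ⟨x, φ⟩`. [cite: BertoliniDarmon1996, §1.9] -/
theorem divisorValue_apply (S : Brandt.XiSetup Nplus Nminus) (φ : Brandt.ClassSet S.O → ℤ)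
    (f : GrossSpace S.D K →₀ ℤ) :
    divisorValue S φ f = f.sum fun x n => n * GrossSpace.yValue S φ x := by
  rw [divisorValue, Finsupp.linearCombination_apply]
  rfl

end GrossSpace

/-! ### §3. Kolyvagin choices at conductor `c` and the derived divisor `P(c)` -/

variable (K) in
/-- **The choices of Zhang 2014 §3.7 at conductor `c`, in `Pic(𝒪_c)`** (`= Gal(K[c]/K)` by class
field theory): for every prime `ℓ ∣ c` an element `σ ℓ` of
`G_ℓ := ker(Pic(𝒪_c) → Pic(𝒪_{c/ℓ}))` (`= Gal(K[c]/K[c/ℓ]) ≅ Gal(K[ℓ]/K[1])`, "cyclic of order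
`ℓ + 1`"; the projection is the tree's `picRes`) GENERATING `G_ℓ` ("choose a generator `σ_ℓ` of
`G_ℓ`"), and a finite set `reps` of representatives of `Pic(𝒪_c)` modulo the subgroup generated by
the `σ ℓ` (`= G_c = ∏_{ℓ ∣ c} G_ℓ = Gal(K[c]/K[1])`; "fix a set `𝒢` of representatives of `𝒢_n/G_n`").
The values of `σ` off the prime factors of `c` are irrelevant. Definite-side counterpart of the tree's
`RingClassKolyvaginChoice` / `KolyvaginHeegnerData.σ, .S`. [cite: WZhang2014, §3.7 (PDF p. 212)]
[cite: GrossLMS1991, §3–§4 (4.1)] -/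
structure GrossKolyvaginChoice (c : ℕ) : Type u where
  /-- `σ ℓ`, for a prime `ℓ ∣ c`: the chosen generator of `G_ℓ = ker(Pic(𝒪_c) → Pic(𝒪_{c/ℓ}))`. -/
  σ : ℕ → ClassGroup (quadOrder K c)
  /-- `σ ℓ` restricts trivially to conductor `c/ℓ`. -/
  σ_mem : ∀ (ℓ : ℕ) (hℓ : ℓ ∈ c.primeFactors),
    picRes K (Nat.div_dvd_of_dvd (Nat.dvd_of_mem_primeFactors hℓ)) (σ ℓ) = 1
  /-- `σ ℓ` generates `G_ℓ`: every class restricting trivially to conductor `c/ℓ` is a power of `σ ℓ`. -/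
  σ_gen : ∀ (ℓ : ℕ) (hℓ : ℓ ∈ c.primeFactors) (τ : ClassGroup (quadOrder K c)),
    picRes K (Nat.div_dvd_of_dvd (Nat.dvd_of_mem_primeFactors hℓ)) τ = 1 →
      τ ∈ Subgroup.zpowers (σ ℓ)
  /-- `𝒢`: a finite set of representatives of `Pic(𝒪_c) / ⟨σ ℓ : ℓ ∣ c⟩`. -/
  reps : Finset (ClassGroup (quadOrder K c))
  /-- `𝒢` is a transversal: every class is congruent to exactly one representative modulo the
  subgroup generated by the `σ ℓ`, `ℓ ∣ c` prime. -/
  reps_transversal : ∀ τ : ClassGroup (quadOrder K c), ∃! s, s ∈ reps ∧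
    s⁻¹ * τ ∈ Subgroup.closure (Set.range fun ℓ : c.primeFactors => σ ℓ)

namespace GrossKolyvaginChoice

section Divisor

variable {c : ℕ} [NeZero c]

/-- **The Kolyvagin-derived divisor `P(c) := Σ_{s ∈ 𝒢} s • D_c [x] ∈ ℤ[GrossSpace]`** of a point `x`
(intended: a Gross point of the squarefree conductor `c`), with `D_c = ∏_{ℓ ∣ c} D_ℓ`,
`D_ℓ = Σ_{i=1}^{ℓ} i (σ ℓ)^i`, run along `c.primeFactorsList` — literally the tree's generic
`KolyvaginOperator.derivedPoint` for the divisor representation of `Pic(𝒪_c)` (Zhang 2014 §3.7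
`P(n) = Σ_{σ ∈ 𝒢} σ(D_n y(n))`, read on the Shimura set through §3.3 and Thm. 3.1).
[cite: WZhang2014, §3.7 (PDF p. 212), §3.3 (3.9)–(3.11), Thm. 3.1] [cite: GrossLMS1991, §4 (4.1)] -/
def derivedDivisor (ch : GrossKolyvaginChoice K c) (x : GrossSpace D K) : GrossSpace D K →₀ ℤ :=
  KolyvaginOperator.derivedPoint (GrossSpace.divisorRep D K c) ch.σ c ch.reps (Finsupp.single x 1)

/-- Unfolding of `derivedDivisor`. [cite: WZhang2014, §3.7 (PDF p. 212)] -/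
theorem derivedDivisor_def (ch : GrossKolyvaginChoice K c) (x : GrossSpace D K) :
    ch.derivedDivisor x = ∑ s ∈ ch.reps, GrossSpace.divisorRep D K c s
      (KolyvaginOperator.derivOpProd (GrossSpace.divisorRep D K c) ch.σ c.primeFactorsList
        (Finsupp.single x 1)) :=
  rfl

variable {Nplus Nminus : ℕ}

/-- **The derived value `⟨P(c), φ⟩ ∈ ℤ`** of a point `x` of the Gross space of a Brandt setup `S`
against a Brandt-module vector `φ : Cls O → ℤ`: `Σ_{s ∈ 𝒢} ⟨s • D_c [x], φ⟩` (Zhang 2014: `φ`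
evaluated on the derived divisor, PDF pp. 218–220; before reduction modulo `p`).
[cite: WZhang2014, (4.7)–(4.9) (PDF pp. 218–219), §3.7] -/
def derivedValue (S : Brandt.XiSetup Nplus Nminus) (φ : Brandt.ClassSet S.O → ℤ)
    (ch : GrossKolyvaginChoice K c) (x : GrossSpace S.D K) : ℤ :=
  GrossSpace.divisorValue S φ (ch.derivedDivisor x)

/-- **The derived value modulo `p`**, `⟨P(c), φ⟩ mod p ∈ ℤ/p` (Zhang's `φ(·) ∈ k₀ = 𝔽_p` for a
mod-`p` eigenform `φ`, (4.7)). [cite: WZhang2014, (4.7)–(4.9) (PDF pp. 218–219)] -/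
def derivedValueMod (p : ℕ) (S : Brandt.XiSetup Nplus Nminus) (φ : Brandt.ClassSet S.O → ℤ)
    (ch : GrossKolyvaginChoice K c) (x : GrossSpace S.D K) : ZMod p :=
  (derivedValue S φ ch x : ZMod p)

/-- `derivedValueMod` is the cast of `derivedValue` (definitional). [cite: WZhang2014, (4.7)–(4.9) (PDF pp. 218–219)] -/
theorem derivedValueMod_def (p : ℕ) (S : Brandt.XiSetup Nplus Nminus)
    (φ : Brandt.ClassSet S.O → ℤ) (ch : GrossKolyvaginChoice K c) (x : GrossSpace S.D K) :
    derivedValueMod p S φ ch x = (derivedValue S φ ch x : ZMod p) :=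
  rfl

/-- `⟨P(c), φ⟩ ≡ 0 (mod p) ↔ p ∣ ⟨P(c), φ⟩`. [cite: WZhang2014, (4.7)–(4.9) (PDF pp. 218–219)] -/
theorem derivedValueMod_eq_zero_iff (p : ℕ) (S : Brandt.XiSetup Nplus Nminus)
    (φ : Brandt.ClassSet S.O → ℤ) (ch : GrossKolyvaginChoice K c) (x : GrossSpace S.D K) :
    derivedValueMod p S φ ch x = 0 ↔ (p : ℤ) ∣ derivedValue S φ ch x := by
  rw [derivedValueMod_def, ZMod.intCast_zmod_eq_zero_iff_dvd]

end Divisor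

/-! ### §4. Conductor `1`: `D_1 = 1`, `P(1) = Σ_{s ∈ 𝒢} s • [x]` -/

section One

/-- At conductor `1` the derivative operator is trivial: `P(1) = Σ_{s ∈ 𝒢} [s • x]`
(Zhang 2014 (3.22): `P(1) = tr_{K[1]/K} y(1) = y_K`; Gross 1991 §4: `P_1 = Σ_{σ ∈ S} σ y_1`).
[cite: WZhang2014, (3.22) (PDF p. 213)] [cite: GrossLMS1991, §4 (P_1 = y_K)] -/
theorem derivedDivisor_one (ch : GrossKolyvaginChoice K 1) (x : GrossSpace D K) :
    ch.derivedDivisor x = ∑ s ∈ ch.reps, Finsupp.single (s • x) 1 := by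
  rw [derivedDivisor, KolyvaginOperator.derivedPoint_one]
  exact sum_congr rfl fun s _ => GrossSpace.divisorRep_single 1 s x 1

variable {Nplus Nminus : ℕ}

/-- **At conductor `1`, `⟨P(1), φ⟩ = Σ_{s ∈ 𝒢} ⟨s • x, φ⟩`** — the shape of Gross's period
`Σ_{σ ∈ Pic(𝓞_K)} ⟨σ x, φ⟩` along the conductor-`1` CM orbit (Gross 1987 §3; Zhang 2014 (6.1)–(6.2)).
[cite: WZhang2014, (3.22), (6.1)–(6.2)] [cite: Gross1987, §3] -/
theorem derivedValue_one (S : Brandt.XiSetup Nplus Nminus) (φ : Brandt.ClassSet S.O → ℤ)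
    (ch : GrossKolyvaginChoice K 1) (x : GrossSpace S.D K) :
    derivedValue S φ ch x = ∑ s ∈ ch.reps, GrossSpace.yValue S φ (s • x) := by
  rw [derivedValue, derivedDivisor_one, map_sum]
  exact sum_congr rfl fun s _ => by rw [GrossSpace.divisorValue_single, one_mul]

variable (K) in
/-- **The canonical choice at conductor `1`**: no primes, `𝒢 = Pic(𝓞_K)` (all of
`ClassGroup (quadOrder K 1)`; `quadOrder K 1 = 𝓞_K`, `quadOrder_one`), for a `Fintype` structure on
the (finite) class group. [cite: WZhang2014, (3.22)] -/
def one [Fintype (ClassGroup (quadOrder K 1))] : GrossKolyvaginChoice K 1 where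
  σ := fun _ => 1
  σ_mem := fun ℓ hℓ => by simp [Nat.primeFactors_one] at hℓ
  σ_gen := fun ℓ hℓ => by simp [Nat.primeFactors_one] at hℓ
  reps := Finset.univ
  reps_transversal := fun τ => by
    have hbot : Subgroup.closure (Set.range fun ℓ : (1 : ℕ).primeFactors =>
        (1 : ClassGroup (quadOrder K 1))) = ⊥ := by
      rw [Subgroup.closure_eq_bot_iff]
      rintro _ ⟨ℓ, rfl⟩
      rfl
    refine ⟨τ, ⟨Finset.mem_univ τ, by rw [inv_mul_cancel]; exact Subgroup.one_mem _⟩, ?_⟩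
    rintro s ⟨-, hs⟩
    rw [hbot, Subgroup.mem_bot, inv_mul_eq_one] at hs
    exact hs

omit [NumberField K] in
/-- The representatives of the canonical conductor-`1` choice are all of `Pic(𝓞_K)`. [cite: WZhang2014, (3.22) (PDF p. 213)] -/
@[simp] theorem one_reps [Fintype (ClassGroup (quadOrder K 1))] :
    (one K).reps = Finset.univ :=
  rfl

/-- **`⟨P(1), φ⟩ = Σ_{σ ∈ Pic(𝓞_K)} ⟨σ • x, φ⟩` for the canonical choice** — Gross's period of `φ`
along the conductor-`1` orbit of `x` (Gross 1987 §3; Zhang 2014 (6.1)–(6.2), Cor. 6.2), as a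
`Fintype` sum and as a `finsum`. [cite: Gross1987, §3] [cite: WZhang2014, (6.1)–(6.2)] -/
theorem derivedValue_one_eq_sum_univ [Fintype (ClassGroup (quadOrder K 1))]
    (S : Brandt.XiSetup Nplus Nminus) (φ : Brandt.ClassSet S.O → ℤ) (x : GrossSpace S.D K) :
    derivedValue S φ (one K) x = ∑ s : ClassGroup (quadOrder K 1), GrossSpace.yValue S φ (s • x) ∧
    derivedValue S φ (one K) x = ∑ᶠ s : ClassGroup (quadOrder K 1), GrossSpace.yValue S φ (s • x) := by
  refine ⟨derivedValue_one S φ (one K) x, ?_⟩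
  rw [derivedValue_one, one_reps, finsum_eq_sum_of_fintype]

end One

/-! ### §5. Prime conductor `ℓ`: `P(ℓ) = Σ_{s ∈ 𝒢} Σ_{i=1}^{ℓ} i [(s σ_ℓ^i) • x]` -/

section Prime

variable {ℓ : ℕ} [NeZero ℓ]

/-- At a PRIME conductor `ℓ`, `D_ℓ [x] = Σ_{i ≤ ℓ} i [σ_ℓ^i • x]` and
`P(ℓ) = Σ_{s ∈ 𝒢} Σ_{i=0}^{ℓ} i [(s σ_ℓ^i) • x]`. [cite: WZhang2014, §3.7 (PDF p. 212)] -/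
theorem derivedDivisor_prime (hℓ : ℓ.Prime) (ch : GrossKolyvaginChoice K ℓ) (x : GrossSpace D K) :
    ch.derivedDivisor x =
      ∑ s ∈ ch.reps, ∑ i ∈ range (ℓ + 1), i • Finsupp.single ((s * ch.σ ℓ ^ i) • x) (1 : ℤ) := by
  rw [derivedDivisor_def, Nat.primeFactorsList_prime hℓ, KolyvaginOperator.derivOpProd_cons,
    KolyvaginOperator.derivOpProd_nil]
  refine sum_congr rfl fun s _ => ?_
  unfold KolyvaginOperator.derivOp
  rw [map_sum]
  refine sum_congr rfl fun i _ => ?_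
  rw [map_nsmul, GrossSpace.divisorRep_single, GrossSpace.divisorRep_single, mul_smul]

variable {Nplus Nminus : ℕ}

/-- At a prime conductor `ℓ`, `⟨P(ℓ), φ⟩ = Σ_{s ∈ 𝒢} Σ_{i=0}^{ℓ} i ⟨(s σ_ℓ^i) • x, φ⟩`.
[cite: WZhang2014, §3.7 (PDF p. 212), (4.7)–(4.9)] -/
theorem derivedValue_prime (hℓ : ℓ.Prime) (S : Brandt.XiSetup Nplus Nminus)
    (φ : Brandt.ClassSet S.O → ℤ) (ch : GrossKolyvaginChoice K ℓ) (x : GrossSpace S.D K) :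
    derivedValue S φ ch x =
      ∑ s ∈ ch.reps, ∑ i ∈ range (ℓ + 1), (i : ℤ) * GrossSpace.yValue S φ ((s * ch.σ ℓ ^ i) • x) := by
  rw [derivedValue, derivedDivisor_prime hℓ, map_sum]
  refine sum_congr rfl fun s _ => ?_
  rw [map_sum]
  refine sum_congr rfl fun i _ => ?_
  rw [map_nsmul, GrossSpace.divisorValue_single, one_mul, nsmul_eq_mul]

end Prime

/-! ### §6. The `G_c`-invariance mechanism on divisors (head prime) -/

section Invariance

variable {c : ℕ} [NeZero c]

/-- **`(σ_ℓ − 1) D_{ℓ::L} [x]` on divisors**: for the divisor representation and a list `ℓ :: L` with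
`(σ ℓ)^{ℓ+1} = 1`, `σ_ℓ • D_{ℓ::L} f − D_{ℓ::L} f = (ℓ + 1) • D_L f − Tr_ℓ (D_L f)` — the identity
from which the `Gal(K[n]/K)`-invariance of `P(n)` modulo `p` is derived once `p ∣ ℓ + 1` and the
norm relation puts `Tr_ℓ` of the conductor-`c` point in `a_ℓ ·`(conductor `c/ℓ`) (Gross 1991
Prop. 3.6 / 3.7; Zhang 2014 p. 212; the norm relations themselves — BD96 §2.4 on the definite side —
are not stated here). [cite: GrossLMS1991, §3 (3.5), Prop. 3.6] [cite: WZhang2014, §3.7 (PDF p. 212)] -/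
theorem divisorRep_derivOpProd_cons_sub (ch : GrossKolyvaginChoice K c) (ℓ : ℕ) (L : List ℕ)
    (hσ : ch.σ ℓ ^ (ℓ + 1) = 1) (f : GrossSpace D K →₀ ℤ) :
    GrossSpace.divisorRep D K c (ch.σ ℓ)
        (KolyvaginOperator.derivOpProd (GrossSpace.divisorRep D K c) ch.σ (ℓ :: L) f) -
      KolyvaginOperator.derivOpProd (GrossSpace.divisorRep D K c) ch.σ (ℓ :: L) f =
    (ℓ + 1) • KolyvaginOperator.derivOpProd (GrossSpace.divisorRep D K c) ch.σ L f -
      KolyvaginOperator.derivOpProd (GrossSpace.divisorRep D K c) ch.σ L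
        (KolyvaginOperator.traceOp (GrossSpace.divisorRep D K c) (ch.σ ℓ) ℓ f) := by
  rw [KolyvaginOperator.apply_derivOpProd_cons_sub _ ch.σ ℓ L hσ f,
    KolyvaginOperator.traceOp_derivOpProd_comm]

end Invariance

/-! ### §7. Transversals exist; the choice determined by generators; the representative map -/

section Transversal

variable {c : ℕ}

omit [NumberField K]

/-- **A transversal `𝒢` of `Pic(𝒪_c)` modulo `⟨σ ℓ : ℓ ∣ c⟩` exists** for any assignment `σ`
(left-coset representatives of a subgroup of a finite group; Zhang 2014 §3.7 "Fix a set `𝒢` of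
representatives of `𝒢_n/G_n`" — here justified). [cite: WZhang2014, §3.7 (PDF p. 212)] -/
theorem exists_reps [Finite (ClassGroup (quadOrder K c))] (σ : ℕ → ClassGroup (quadOrder K c)) :
    ∃ reps : Finset (ClassGroup (quadOrder K c)), ∀ τ : ClassGroup (quadOrder K c), ∃! s, s ∈ reps ∧
      s⁻¹ * τ ∈ Subgroup.closure (Set.range fun ℓ : c.primeFactors => σ ℓ) := by
  classical
  set H : Subgroup (ClassGroup (quadOrder K c)) :=
    Subgroup.closure (Set.range fun ℓ : c.primeFactors => σ ℓ)
  obtain ⟨S, hS, -⟩ := H.exists_isComplement_left 1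
  refine ⟨(Set.toFinite S).toFinset, fun τ => ?_⟩
  obtain ⟨s, hs, huniq⟩ := (Subgroup.isComplement_iff_existsUnique_inv_mul_mem.mp hS) τ
  refine ⟨s, ⟨(Set.toFinite S).mem_toFinset.mpr s.2, hs⟩, ?_⟩
  rintro t ⟨ht, ht'⟩
  exact congrArg Subtype.val (huniq ⟨t, (Set.toFinite S).mem_toFinset.mp ht⟩ ht')

variable (K) in
/-- **The Kolyvagin choice determined by generators alone**: given `σ ℓ` generating
`G_ℓ = ker(Pic(𝒪_c) → Pic(𝒪_{c/ℓ}))` for the primes `ℓ ∣ c`, SOME transversal `𝒢` is chosen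
(`exists_reps`; Zhang 2014 §3.7: `σ_ℓ` is chosen, then "fix a set `𝒢` of representatives").
[cite: WZhang2014, §3.7 (PDF p. 212)] -/
def ofGenerators [Finite (ClassGroup (quadOrder K c))] (σ : ℕ → ClassGroup (quadOrder K c))
    (σ_mem : ∀ (ℓ : ℕ) (hℓ : ℓ ∈ c.primeFactors),
      picRes K (Nat.div_dvd_of_dvd (Nat.dvd_of_mem_primeFactors hℓ)) (σ ℓ) = 1)
    (σ_gen : ∀ (ℓ : ℕ) (hℓ : ℓ ∈ c.primeFactors) (τ : ClassGroup (quadOrder K c)),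
      picRes K (Nat.div_dvd_of_dvd (Nat.dvd_of_mem_primeFactors hℓ)) τ = 1 →
        τ ∈ Subgroup.zpowers (σ ℓ)) :
    GrossKolyvaginChoice K c where
  σ := σ
  σ_mem := σ_mem
  σ_gen := σ_gen
  reps := (exists_reps σ).choose
  reps_transversal := (exists_reps σ).choose_spec

/-- The generators of `ofGenerators` are the given ones (definitional). [cite: WZhang2014, §3.7 (PDF p. 212)] -/
@[simp] theorem ofGenerators_σ [Finite (ClassGroup (quadOrder K c))]
    (σ : ℕ → ClassGroup (quadOrder K c)) (σ_mem σ_gen) :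
    (ofGenerators K σ σ_mem σ_gen).σ = σ :=
  rfl

/-- **The subgroup `G_c := ⟨σ ℓ : ℓ ∣ c⟩` of a choice** (`= Gal(K[c]/K[1]) = ∏ G_ℓ` for genuine
Kolyvagin data; Zhang 2014 §3.7 `G_n = ∏_{ℓ ∣ n} G_ℓ`). [cite: WZhang2014, §3.7 (PDF p. 212)] -/
def subgroup (ch : GrossKolyvaginChoice K c) : Subgroup (ClassGroup (quadOrder K c)) :=
  Subgroup.closure (Set.range fun ℓ : c.primeFactors => ch.σ ℓ)

/-- `σ ℓ ∈ G_c` for `ℓ ∣ c` prime. [cite: WZhang2014, §3.7 (PDF p. 212)] -/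
theorem σ_mem_subgroup (ch : GrossKolyvaginChoice K c) {ℓ : ℕ} (hℓ : ℓ ∈ c.primeFactors) :
    ch.σ ℓ ∈ ch.subgroup :=
  Subgroup.subset_closure ⟨⟨ℓ, hℓ⟩, rfl⟩

/-- **The representative `𝒢(τ) ∈ 𝒢` of the `G_c`-coset of `τ`** (the unique `s ∈ 𝒢` with
`s⁻¹ τ ∈ G_c`). [cite: WZhang2014, §3.7 (PDF p. 212)] -/
def rep (ch : GrossKolyvaginChoice K c) (τ : ClassGroup (quadOrder K c)) : ClassGroup (quadOrder K c) :=
  (ch.reps_transversal τ).choose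

/-- `𝒢(τ) ∈ 𝒢`. [cite: WZhang2014, §3.7 (PDF p. 212)] -/
theorem rep_mem (ch : GrossKolyvaginChoice K c) (τ : ClassGroup (quadOrder K c)) : ch.rep τ ∈ ch.reps :=
  (ch.reps_transversal τ).choose_spec.1.1

/-- `𝒢(τ)⁻¹ τ ∈ G_c`. [cite: WZhang2014, §3.7 (PDF p. 212)] -/
theorem rep_inv_mul_mem (ch : GrossKolyvaginChoice K c) (τ : ClassGroup (quadOrder K c)) :
    (ch.rep τ)⁻¹ * τ ∈ ch.subgroup :=
  (ch.reps_transversal τ).choose_spec.1.2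

/-- Uniqueness: an `s ∈ 𝒢` with `s⁻¹ τ ∈ G_c` IS `𝒢(τ)`. [cite: WZhang2014, §3.7 (PDF p. 212)] -/
theorem eq_rep_of_mem (ch : GrossKolyvaginChoice K c) {τ s : ClassGroup (quadOrder K c)}
    (hs : s ∈ ch.reps) (hsτ : s⁻¹ * τ ∈ ch.subgroup) : s = ch.rep τ :=
  (ch.reps_transversal τ).choose_spec.2 s ⟨hs, hsτ⟩

/-- A representative represents itself: `𝒢(s) = s` for `s ∈ 𝒢`. [cite: WZhang2014, §3.7 (PDF p. 212)] -/
theorem rep_eq_self_of_mem (ch : GrossKolyvaginChoice K c) {s : ClassGroup (quadOrder K c)}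
    (hs : s ∈ ch.reps) : ch.rep s = s :=
  (ch.eq_rep_of_mem hs (by rw [inv_mul_cancel]; exact Subgroup.one_mem _)).symm

/-- Two representatives in the same `G_c`-coset are equal. [cite: WZhang2014, §3.7 (PDF p. 212)] -/
theorem eq_of_mem_reps_of_inv_mul_mem (ch : GrossKolyvaginChoice K c)
    {s t : ClassGroup (quadOrder K c)} (hs : s ∈ ch.reps) (ht : t ∈ ch.reps)
    (hst : s⁻¹ * t ∈ ch.subgroup) : s = t := by
  rw [ch.eq_rep_of_mem hs hst, ch.rep_eq_self_of_mem ht]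

end Transversal

/-! ### §8. Support: `P(c)` of a Gross point of conductor `c` is a divisor on Gross points of conductor `c` -/

section Support

variable {c : ℕ} [NeZero c]

/-- A `Pic(𝒪_c)`-stable set `T` of points: divisors supported in `T` are stable under the divisor
representation. [cite: BertoliniDarmon1996, §2.3 (4)] -/
theorem _root_.Literature.NumberTheory.EllipticCurves.GrossSpace.divisorRep_mem_supported
    {T : Set (GrossSpace D K)} (hT : ∀ (g : ClassGroup (quadOrder K c)) (y : GrossSpace D K),
      y ∈ T → g • y ∈ T) (g : ClassGroup (quadOrder K c)) {f : GrossSpace D K →₀ ℤ}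
    (hf : f ∈ Finsupp.supported ℤ ℤ T) : GrossSpace.divisorRep D K c g f ∈ Finsupp.supported ℤ ℤ T := by
  classical
  rw [Finsupp.mem_supported] at hf ⊢
  rw [GrossSpace.divisorRep_apply]
  intro y hy
  obtain ⟨x, hx, rfl⟩ := Finset.mem_image.mp (Finsupp.mapDomain_support hy)
  exact hT g x (hf hx)

/-- Divisors supported in a `Pic(𝒪_c)`-stable set are stable under `D_L`. [cite: WZhang2014, §3.7 (PDF p. 212)] -/
theorem _root_.Literature.NumberTheory.EllipticCurves.GrossSpace.derivOpProd_mem_supported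
    {T : Set (GrossSpace D K)} (hT : ∀ (g : ClassGroup (quadOrder K c)) (y : GrossSpace D K),
      y ∈ T → g • y ∈ T) (σ : ℕ → ClassGroup (quadOrder K c)) (L : List ℕ)
    {f : GrossSpace D K →₀ ℤ} (hf : f ∈ Finsupp.supported ℤ ℤ T) :
    KolyvaginOperator.derivOpProd (GrossSpace.divisorRep D K c) σ L f ∈ Finsupp.supported ℤ ℤ T := by
  induction L with
  | nil => exact hf
  | cons ℓ L ih =>
    rw [KolyvaginOperator.derivOpProd_cons]
    unfold KolyvaginOperator.derivOp
    exact Submodule.sum_mem _ fun i _ =>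
      Submodule.smul_of_tower_mem _ i (GrossSpace.divisorRep_mem_supported hT _ ih)

/-- **`P(c)` is supported in any `Pic(𝒪_c)`-stable set containing `x`** (e.g. the orbit of `x`).
[cite: WZhang2014, §3.7 (PDF p. 212)] -/
theorem derivedDivisor_mem_supported (ch : GrossKolyvaginChoice K c) {T : Set (GrossSpace D K)}
    (hT : ∀ (g : ClassGroup (quadOrder K c)) (y : GrossSpace D K), y ∈ T → g • y ∈ T)
    {x : GrossSpace D K} (hx : x ∈ T) : ch.derivedDivisor x ∈ Finsupp.supported ℤ ℤ T := by
  rw [derivedDivisor_def]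
  refine Submodule.sum_mem _ fun s _ => GrossSpace.divisorRep_mem_supported hT s ?_
  exact GrossSpace.derivOpProd_mem_supported hT ch.σ _ (Finsupp.single_mem_supported ℤ 1 hx)

variable {Nplus Nminus : ℕ}

/-- **The derived divisor of a Gross point of conductor `c` is a divisor on the Gross points of
conductor `c`**: `Pic(𝒪_c)` preserves `grossPoints K S c` (BD96 §2.3 — the tree THEOREM
`picard_smul_mem_grossPoints` of `GrossPointsPicardActionHeegner`, taken here as the hypothesis
`hstab` so that this file does not import that module), so every point in the support of `P(c)` is
again a Heegner point of conductor `c` on the Shimura set (Zhang 2014 §3.3: `x_m(n) ∈ C_{K,m}` and its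
Galois conjugates). [cite: BertoliniDarmon1996, §2.3 (4)] [cite: WZhang2014, §3.3 (3.10), §3.7] -/
theorem derivedDivisor_mem_supported_grossPoints {S : Brandt.XiSetup Nplus Nminus}
    (hstab : ∀ (g : ClassGroup (quadOrder K c)) (y : GrossSpace S.D K),
      y ∈ grossPoints K S c → g • y ∈ grossPoints K S c)
    (ch : GrossKolyvaginChoice K c) {x : GrossSpace S.D K} (hx : x ∈ grossPoints K S c) :
    ch.derivedDivisor x ∈ Finsupp.supported ℤ ℤ (grossPoints K S c) :=
  ch.derivedDivisor_mem_supported hstab hx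

/-- Pointwise form: every point in the support of `P(c)` is a Gross point of conductor `c`
(`hstab` = `picard_smul_mem_grossPoints`). [cite: BertoliniDarmon1996, §2.3 (4)] [cite: WZhang2014, §3.3 (3.10), §3.7] -/
theorem mem_grossPoints_of_mem_support_derivedDivisor {S : Brandt.XiSetup Nplus Nminus}
    (hstab : ∀ (g : ClassGroup (quadOrder K c)) (y : GrossSpace S.D K),
      y ∈ grossPoints K S c → g • y ∈ grossPoints K S c)
    (ch : GrossKolyvaginChoice K c) {x : GrossSpace S.D K} (hx : x ∈ grossPoints K S c)
    {y : GrossSpace S.D K} (hy : y ∈ (ch.derivedDivisor x).support) : y ∈ grossPoints K S c :=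
  (Finsupp.mem_supported _ _).mp (ch.derivedDivisor_mem_supported_grossPoints hstab hx) hy

end Support

end GrossKolyvaginChoice

end Literature.NumberTheory.EllipticCurves

end
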